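import Summits.AtomisticToContinuum.HydrodynamicLimit.Theses.HeatBathForgetting
import Summits.AtomisticToContinuum.HydrodynamicLimit.Theorems.OneFlightGossipEngineUniformLocalGibbsConcentration

/-!
# `LocalGibbsConcentration` PROVED (route `HeatBathForgetting`) — exponential LLN for canonical local Gibbs states at small reduced density

Support item stmt-AtomisticToContinuum-9246 (route `HeatBathForgetting` of
`AtomisticToContinuum/HydrodynamicLimit`; same signature as the shared item 0767): for continuous
profiles `a, θ₀ > 0`, `u₀` there is `σ₀ > 0` such that for every reduced diameter `0 < σ < σ₀` the
canonical local Gibbs laws `localGibbsLaw σ a u₀ θ₀ N Φ` are probability measures and their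
empirical density / momentum / energy fields, tested against any continuous `χ`, concentrate
exponentially (`≤ C e^{-(N+1)/C}` for all `N` and all flows) around `∫χρ₀`, `∫(χρ₀)u₀`,
`∫χE(ρ₀,u₀,θ₀)` for a continuous positive density `ρ₀`.

Proof: the tree already holds the `η₀`-UNIFORM version
`uniformLocalGibbsConcentration_proof` (item stmt-AtomisticToContinuum-14445, file
`OneFlightGossipEngineUniformLocalGibbsConcentration`: one `η₀ > 0` works for every profile under
the activity-ratio guard `σ³ · sup a ≤ η₀ ∫ a`). Given `a`, put `σ₀ := (η₀ ∫a / sup a)^{1/3} > 0`;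
then `σ < σ₀` gives `σ³ < η₀ ∫a / sup a`, i.e. the guard, and the uniform statement applies verbatim.
Sources: Ruelle 1969 §4, Lebowitz–Penrose 1964 (low-density expansion, through the cited file).
-/

noncomputable section

namespace Summit.AtomisticToContinuum.HydrodynamicLimit.Theorems

open MeasureTheory Filter Set Topology
open Literature.MathematicalPhysics.KineticTheory

/-- **Exponential law of large numbers for canonical local Gibbs states of hard spheres at small
reduced density** (`HeatBathForgetting.LocalGibbsConcentration`, stmt-AtomisticToContinuum-9246):
for continuous `a, θ₀ > 0`, `u₀` there is `σ₀ > 0` (namely `(η₀ ∫a / sup a)^{1/3}` with the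
universal `η₀` of `uniformLocalGibbsConcentration_proof`) such that for `0 < σ < σ₀` the local
Gibbs laws are probability measures and the three empirical fields concentrate exponentially
around the fields of a continuous positive density `ρ₀`. Reduction to the `η₀`-uniform theorem. -/
theorem heatBathForgetting_localGibbsConcentration_proof :
    Summit.AtomisticToContinuum.HydrodynamicLimit.Theses.HeatBathForgetting.LocalGibbsConcentration := by
  unfold Summit.AtomisticToContinuum.HydrodynamicLimit.Theses.HeatBathForgetting.LocalGibbsConcentration
  obtain ⟨η₀, hη₀, H⟩ := uniformLocalGibbsConcentration_proof
  intro a θ₀ u₀ ha hθ hu ha0 hθ0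
  -- the supremum and the integral of the activity are positive
  have hbdd : BddAbove (Set.range a) := (isCompact_range ha).bddAbove
  have hsup_ge : ∀ x, a x ≤ ⨆ y, a y := fun x => le_ciSup hbdd x
  have hsup_pos : 0 < ⨆ y, a y := (ha0 0).trans_le (hsup_ge 0)
  have hint_pos : 0 < ∫ y, a y := integral_pos_of_continuous_pos ha ha0
  set R : ℝ := η₀ * (∫ y, a y) / ⨆ y, a y with hR
  have hR0 : 0 < R := by positivity
  refine ⟨R ^ (1 / 3 : ℝ), Real.rpow_pos_of_pos hR0 _, fun σ hσ hσlt => ?_⟩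
  refine H a θ₀ u₀ ha hθ hu ha0 hθ0 σ hσ ?_
  -- `σ < R^{1/3}` gives `σ³ < R = η₀ ∫a / sup a`, i.e. the activity-ratio guard
  have hR3 : (R ^ (1 / 3 : ℝ)) ^ 3 = R := by
    rw [← Real.rpow_natCast, ← Real.rpow_mul hR0.le]
    norm_num
  have h3 : σ ^ 3 < R := by
    have h := pow_lt_pow_left₀ hσlt hσ.le (three_ne_zero)
    rwa [hR3] at h
  have hne : (⨆ y, a y) ≠ 0 := hsup_pos.ne'
  calc σ ^ 3 * (⨆ y, a y) ≤ R * (⨆ y, a y) := mul_le_mul_of_nonneg_right h3.le hsup_pos.le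
    _ = η₀ * ∫ y, a y := by rw [hR, div_mul_cancel₀ _ hne]

end Summit.AtomisticToContinuum.HydrodynamicLimit.Theorems

end
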